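import Summits.BirchSwinnertonDyer.BirchSwinnertonDyer.Theorems.ManinLocalTwoThreeKatoShiftTwoDvdMultiShiftClass
import Summits.BirchSwinnertonDyer.Rank1Residual.ManinAdditive.KatoShiftTwoLawsEdges
import Summits.BirchSwinnertonDyer.BirchSwinnertonDyer.Theorems.ManinLocalTwoThreeManinOddAtFourResidualSynthesis
import Literature.NumberTheory.EllipticCurves.KatoAdditiveTwistedValueNeronIntegralityTwo

/-!
# Route `ManinLocalTwoThree`, crux C2 `ManinOddAtFour` (stmt-BirchSwinnertonDyer-22967), line `kato-shift-two`
# (es g7): the LEVER end to end — the registered stub `stub_two_dvd_multiShiftClass` from the NAMED `p = 2` Kato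
# fact F-es-21, hence E-es-21 ⟸ F-es-21 ∧ E-es-22 and C2 BY NAME ⟸ F-es-21 ∧ E-es-22 ∧ E-es-23 (a) ∧ (b) — and
# from nothing else (line prover p1; helper)

The `p = 2` twin of `…ManinPrimeToThreeAtNineKatoShiftLever`. With the typer's T-es-10 in the tree — the fact
`kato_neron_isIntegral_twistedSymbolSum_of_additive_two_polar` (`Literature/…/KatoAdditiveTwistedValueNeronIntegralityTwo`),
the leaf `…ManinAdditive.KatoShiftTwoLaws` (`KatoShiftTwistManinTwo` E-es-21, `MultiShiftClassGenerationTwo`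
E-es-22, `ManinOddOfPosDiscAtFour` / `ManinOddOfReducibleAtFour` E-es-23 (a)/(b)) and the edges
`…ManinAdditive.KatoShiftTwoLawsEdges` (vocabulary `genSet` / `multiShiftClass` / `AdmissiblePrimeTwo`, the
lever `katoShiftTwistManinTwo_of_shiftStep`, the split `maninOddAtFour_of_katoShift_of_residuals`) — the
by-value step `exists_int_re_multiShiftClass_eq_two_mul` of `…KatoShiftTwoDvdMultiShiftClass` (whose hypothesis
`hK` is the fact's body VERBATIM) composes BY NAME:
* `stub_two_dvd_multiShiftClass` — VERBATIM the line's registered stub (v2 registration copy, planner-of-record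
  imc g9, `Cruxes/ManinOddAtFour/Lines/kato_shift_two.lean`): granted the fact, at a lattice-optimal datum with
  `4 ∣ N`, `W` additive at `2`, `W[2]` irreducible, `2 ∣ c` and (`Δ_W < 0` or `4 ∣ c`), every multi-shift class
  `Σ_{T ⊆ Gen(N)} (−1)^{|T|} {0, a∏T/ℓ}_f` over an admissible prime `ℓ` has real part in `2ℤ·(Ω⁺_f/2)`.
* `katoShiftTwistManinTwo_of_katoFact_of_generation` — **E-es-21 ⟸ F-es-21 ∧ E-es-22**.
* `maninOddAtFour_of_katoFact_of_generation_of_residuals` — **C2 BY NAME ⟸ F-es-21 ∧ E-es-22 ∧ E-es-23 (a) ∧ (b)**.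
* `maninOddAtFour_of_katoShift_of_minimalResiduals`, `maninOddAtFour_of_katoFact_of_generation_of_minimalResiduals`
  — the same with BOTH residuals restricted to the GLOBALLY TWIST-MINIMAL classes (no dyadic `χ₋₄, χ_{±8}` and
  no odd `χ_{q*}` semistable untwist), through the landed synthesis
  `maninOddAtFour_of_minimalKatoShift_of_minimalResiduals` (`…ManinOddAtFourResidualSynthesis`, seat p2's
  untwisting reductions composed with the E-es-23 split).
HONEST FRAMING: a `proof.conditional`, not a closure — F-es-21 is a statement-only named fact, E-es-22 is a
conjecture (no Ihara lemma at `p = 2 ∣ N`; tested `N = 4k ≤ 800`), the two residuals are open. Manin's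
conjecture at `2` is NOT proved here; nothing about BSD is proved here.
-/

set_option autoImplicit false
set_option linter.dupNamespace false

noncomputable section

open scoped Classical MatrixGroups ModularForm

open CongruenceSubgroup Complex WeierstrassCurve Literature.NumberTheory.EllipticCurves
  Literature.NumberTheory.EllipticCurves.ModularForms
  Summit.BirchSwinnertonDyer.Rank1Residual.ManinAdditive

namespace Summit.BirchSwinnertonDyer.BirchSwinnertonDyer.Theorems.ManinLocalTwoThree

section LeverTwo

/-- **The registered stub `stub_two_dvd_multiShiftClass` of line `kato-shift-two`, PROVED from the NAMED fact**
(signature verbatim the v2 registration copy; = the hypothesis `hE` of the tree's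
`katoShiftTwistManinTwo_of_shiftStep`): granted `kato_neron_isIntegral_twistedSymbolSum_of_additive_two_polar`,
at a lattice-optimal `X₀(N)`-datum `D` of a globally minimal `W` with `4 ∣ N`, `W` additive at `2`, `W[2]`
irreducible, `2 ∣ c` and (`Δ_W < 0` or `4 ∣ c`), for every admissible `ℓ` (`AdmissiblePrimeTwo N ℓ`: `ℓ ∤ N`
prime, `ℓ ≡ 3 (mod 4)`, no `t ∈ Gen(N) = {8} ∪ {q ∥ N}` is `±1 mod ℓ`) and `0 < a < ℓ`, the multi-shift class
has `Re(multiShiftClass D.f ℓ a) = 2n·(Ω⁺_f/2)` for an integer `n` — by `exists_int_re_multiShiftClass_eq_two_mul`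
(plus-side lattice coordinates, even characters of odd order off the holes, the symmetrised Euler `2`-units,
the fact, and Fourier inversion over `(ℤ/ℓ)^×/±1`).
[cite: Kato2004Asterisque, Thm. 9.7 (p. 189)] [cite: KostersPannekoek2017, Thm. 1, §3.3.1] -/
theorem stub_two_dvd_multiShiftClass
    (hK : kato_neron_isIntegral_twistedSymbolSum_of_additive_two_polar) :
    ∀ (W : WeierstrassCurve ℚ) [W.IsElliptic] [W.IsGloballyMinimal] {N : ℕ} [NeZero N]
      (D : ModularParametrizationData W N),
      (∀ z ∈ D.L.lattice, ∃ w ∈ periodLattice D.f, z = D.c * w) → 2 ^ 2 ∣ N →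
      ¬ W.HasGoodReductionAtPrime 2 → ¬ W.HasMultiplicativeReductionAtPrime 2 →
      W.HasIrreducibleModPGaloisRep 2 → (2 : ℤ) ∣ D.c → (W.Δ < 0 ∨ (4 : ℤ) ∣ D.c) →
      ∀ ℓ : ℕ, AdmissiblePrimeTwo N ℓ → ∀ a : ℕ, 0 < a → a < ℓ →
        ∃ n : ℤ, (multiShiftClass D.f ℓ a).re = 2 * n * (plusPeriod D.f / 2) := by
  intro W _ _ N _ D hopt h4 hg hm hirr h2c hΔ ℓ hadm a ha0 haℓ
  obtain ⟨hℓ, hℓN, h4ℓ, hgen⟩ := hadm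
  exact exists_int_re_multiShiftClass_eq_two_mul hK D hopt h4 ⟨hg, hm⟩ hirr h2c hΔ hℓ hℓN h4ℓ hgen a ha0 haℓ

/-- **E-es-21 `KatoShiftTwistManinTwo` ⟸ the `p = 2` Kato fact F-es-21 ∧ the multi-shift generation law
E-es-22** (the tree's lever `katoShiftTwistManinTwo_of_shiftStep` with its remaining stub discharged).
[cite: Kato2004Asterisque, Thm. 9.7 (p. 189)] -/
theorem katoShiftTwistManinTwo_of_katoFact_of_generation
    (hK : kato_neron_isIntegral_twistedSymbolSum_of_additive_two_polar)
    (hG : MultiShiftClassGenerationTwo) : KatoShiftTwistManinTwo :=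
  katoShiftTwistManinTwo_of_shiftStep (stub_two_dvd_multiShiftClass hK) hG

/-- **The crux C2 BY NAME, conditionally**: `ManinOddAtFour` (stmt-BirchSwinnertonDyer-22967) follows from the
`p = 2` Kato fact (tree named fact F-es-21, statement only), the multi-shift generation law
`MultiShiftClassGenerationTwo` (`@[conjecture]` leaf E-es-22) and the two residuals `ManinOddOfPosDiscAtFour`,
`ManinOddOfReducibleAtFour` (`@[conjecture]` leaves E-es-23 (a)/(b)) — and from nothing else; the crux's four
printed-fact binders are not used. A `proof.conditional`, not a closure: three of the four inputs are open.
[cite: Kato2004Asterisque, Thm. 9.7 (p. 189)] -/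
theorem maninOddAtFour_of_katoFact_of_generation_of_residuals
    (hK : kato_neron_isIntegral_twistedSymbolSum_of_additive_two_polar)
    (hG : MultiShiftClassGenerationTwo) (hRa : ManinOddOfPosDiscAtFour) (hRb : ManinOddOfReducibleAtFour) :
    Summit.BirchSwinnertonDyer.BirchSwinnertonDyer.Theses.ManinLocalTwoThree.ManinOddAtFour :=
  maninOddAtFour_of_katoShift_of_residuals (katoShiftTwistManinTwo_of_katoFact_of_generation hK hG) hRa hRb

end LeverTwo

section MinimalResiduals

/-- **C2 ⟸ E-es-21 `KatoShiftTwistManinTwo` ∧ (archimedean residual on the globally twist-minimal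
`W[2]`-irreducible classes) ∧ (Manin at `2` on the globally twist-minimal `W[2]`-reducible classes)**: the
residual leaves `ManinOddOfPosDiscAtFour` / `ManinOddOfReducibleAtFour` are needed only on the optimal curves
whose class has no dyadic (`χ₋₄, χ_{±8}`) and no odd (`χ_{q*}`, `q² ∣ N`) semistable untwist
(`maninOddAtFour_of_minimalKatoShift_of_minimalResiduals` with the certificate unrestricted).
[cite: Stevens1989, Lemmas (5.2), (5.4)] [cite: Kato2004Asterisque, Thm. 9.7 (p. 189)] -/
theorem maninOddAtFour_of_katoShift_of_minimalResiduals (hA : KatoShiftTwistManinTwo)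
    (hRa : ∀ (W : WeierstrassCurve ℚ) [W.IsElliptic] [W.IsGloballyMinimal] {N : ℕ} [NeZero N]
      (D : ModularParametrizationData W N),
      (∀ z ∈ D.L.lattice, ∃ w ∈ periodLattice D.f, z = D.c * w) → 2 ^ 2 ∣ N →
      ¬ (∃ (W' : WeierstrassCurve ℚ) (d : ℤ), W'.IsElliptic ∧ W'.IsGloballyMinimal ∧
        (d = -1 ∨ d = 2 ∨ d = -2) ∧ IsIsogenous W (W'.quadraticTwist (d : ℚ)) ∧
        ¬ 2 ^ 2 ∣ W'.conductorNorm ℤ) →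
      ¬ (∃ (W' : WeierstrassCurve ℚ) (q : ℕ), W'.IsElliptic ∧ W'.IsGloballyMinimal ∧
        q.Prime ∧ q ≠ 2 ∧ q ^ 2 ∣ N ∧
        IsIsogenous W (W'.quadraticTwist (((-1 : ℤ) ^ (q / 2) * q : ℤ) : ℚ)) ∧
        ¬ q ^ 2 ∣ W'.conductorNorm ℤ) →
      W.HasIrreducibleModPGaloisRep 2 → 0 < W.Δ → ¬ (4 : ℤ) ∣ D.c → ¬ (2 : ℤ) ∣ D.c)
    (hRb : ∀ (W : WeierstrassCurve ℚ) [W.IsElliptic] [W.IsGloballyMinimal] {N : ℕ} [NeZero N]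
      (D : ModularParametrizationData W N),
      (∀ z ∈ D.L.lattice, ∃ w ∈ periodLattice D.f, z = D.c * w) → 2 ^ 2 ∣ N →
      ¬ (∃ (W' : WeierstrassCurve ℚ) (d : ℤ), W'.IsElliptic ∧ W'.IsGloballyMinimal ∧
        (d = -1 ∨ d = 2 ∨ d = -2) ∧ IsIsogenous W (W'.quadraticTwist (d : ℚ)) ∧
        ¬ 2 ^ 2 ∣ W'.conductorNorm ℤ) →
      ¬ (∃ (W' : WeierstrassCurve ℚ) (q : ℕ), W'.IsElliptic ∧ W'.IsGloballyMinimal ∧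
        q.Prime ∧ q ≠ 2 ∧ q ^ 2 ∣ N ∧
        IsIsogenous W (W'.quadraticTwist (((-1 : ℤ) ^ (q / 2) * q : ℤ) : ℚ)) ∧
        ¬ q ^ 2 ∣ W'.conductorNorm ℤ) →
      ¬ W.HasIrreducibleModPGaloisRep 2 → ¬ (2 : ℤ) ∣ D.c) :
    Summit.BirchSwinnertonDyer.BirchSwinnertonDyer.Theses.ManinLocalTwoThree.ManinOddAtFour :=
  maninOddAtFour_of_minimalKatoShift_of_minimalResiduals (fun W _ _ _ _ D hopt h4 _ _ hirr => hA W D hopt h4 hirr)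
    hRa hRb

/-- **C2 ⟸ the `p = 2` Kato fact F-es-21 ∧ the multi-shift generation law E-es-22 ∧ (both residuals on the
globally twist-minimal classes)** — the line `kato-shift-two` end to end with the smallest residuals the landed
reductions allow. A `proof.conditional`: the fact is statement-only, the law is a conjecture, the residuals are
open. [cite: Kato2004Asterisque, Thm. 9.7 (p. 189)] [cite: Stevens1989, Lemmas (5.2), (5.4)] -/
theorem maninOddAtFour_of_katoFact_of_generation_of_minimalResiduals
    (hK : kato_neron_isIntegral_twistedSymbolSum_of_additive_two_polar) (hG : MultiShiftClassGenerationTwo)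
    (hRa : ∀ (W : WeierstrassCurve ℚ) [W.IsElliptic] [W.IsGloballyMinimal] {N : ℕ} [NeZero N]
      (D : ModularParametrizationData W N),
      (∀ z ∈ D.L.lattice, ∃ w ∈ periodLattice D.f, z = D.c * w) → 2 ^ 2 ∣ N →
      ¬ (∃ (W' : WeierstrassCurve ℚ) (d : ℤ), W'.IsElliptic ∧ W'.IsGloballyMinimal ∧
        (d = -1 ∨ d = 2 ∨ d = -2) ∧ IsIsogenous W (W'.quadraticTwist (d : ℚ)) ∧
        ¬ 2 ^ 2 ∣ W'.conductorNorm ℤ) →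
      ¬ (∃ (W' : WeierstrassCurve ℚ) (q : ℕ), W'.IsElliptic ∧ W'.IsGloballyMinimal ∧
        q.Prime ∧ q ≠ 2 ∧ q ^ 2 ∣ N ∧
        IsIsogenous W (W'.quadraticTwist (((-1 : ℤ) ^ (q / 2) * q : ℤ) : ℚ)) ∧
        ¬ q ^ 2 ∣ W'.conductorNorm ℤ) →
      W.HasIrreducibleModPGaloisRep 2 → 0 < W.Δ → ¬ (4 : ℤ) ∣ D.c → ¬ (2 : ℤ) ∣ D.c)
    (hRb : ∀ (W : WeierstrassCurve ℚ) [W.IsElliptic] [W.IsGloballyMinimal] {N : ℕ} [NeZero N]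
      (D : ModularParametrizationData W N),
      (∀ z ∈ D.L.lattice, ∃ w ∈ periodLattice D.f, z = D.c * w) → 2 ^ 2 ∣ N →
      ¬ (∃ (W' : WeierstrassCurve ℚ) (d : ℤ), W'.IsElliptic ∧ W'.IsGloballyMinimal ∧
        (d = -1 ∨ d = 2 ∨ d = -2) ∧ IsIsogenous W (W'.quadraticTwist (d : ℚ)) ∧
        ¬ 2 ^ 2 ∣ W'.conductorNorm ℤ) →
      ¬ (∃ (W' : WeierstrassCurve ℚ) (q : ℕ), W'.IsElliptic ∧ W'.IsGloballyMinimal ∧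
        q.Prime ∧ q ≠ 2 ∧ q ^ 2 ∣ N ∧
        IsIsogenous W (W'.quadraticTwist (((-1 : ℤ) ^ (q / 2) * q : ℤ) : ℚ)) ∧
        ¬ q ^ 2 ∣ W'.conductorNorm ℤ) →
      ¬ W.HasIrreducibleModPGaloisRep 2 → ¬ (2 : ℤ) ∣ D.c) :
    Summit.BirchSwinnertonDyer.BirchSwinnertonDyer.Theses.ManinLocalTwoThree.ManinOddAtFour :=
  maninOddAtFour_of_katoShift_of_minimalResiduals (katoShiftTwistManinTwo_of_katoFact_of_generation hK hG) hRa hRb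

end MinimalResiduals

end Summit.BirchSwinnertonDyer.BirchSwinnertonDyer.Theorems.ManinLocalTwoThree

end
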